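import Summits.QuantumFields.YangMills.Theorems.BalabanUVNodesN15BackgroundLayerFirstOrderMatrixFull
import Summits.QuantumFields.YangMills.Theorems.BalabanUVNodesN15VectorPieceBackgroundFirstOrder
import HarnessLib

/-!
# Route «BalabanUVNodes» (K4 «SpineRates»), node N15 = NE2 — THE NON-ABELIAN JOINT KNIT: `T4EtaRate.NE2PlusOperator` BY NAME for the U = 1 vector
# single-scale piece acting componentwise on `𝔤 ≅ ℝ^ι`-valued fields (`G ⊗ 1_𝔤`) DRESSED BY THE NON-ABELIAN FIRST-ORDER SPECIES `V = M_C + Σ_μ M_{A_μ}∘∇_μ`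
# (MATRIX coefficients) — background block LIVE ((3.35) on every matrix entry), size guard LIVE, all four (3.42) entries CONSTRUCTED, every U ≡ 1 input a tree theorem

Cell `pub-ymgap`, seat `pub-ymgap-dag-n15-c` (generation g0; R134 ACCELERATION SEAT, strategy s1; n15-b HANDOFF §g5.7 (N1) «free for n15-c»; HUMAN RULING
D-0062; chair R424 venue; `bears_on: R4∕N15`).  Filed `--supports stmt-QuantumFields-19676` (K3 «SpineGivenEndpointR11»; helper).  Plumbing: the componentwise
lift `tensorId ι T = T ⊗ 1_ι` of a real lattice operator to `𝔤`-valued fields (with its majorant and defect transfer), the realised non-abelian instance ∕ family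
(`bgVecInstanceM₁`, `bgVecFamilyM₁4`); then theorems.  Imports BY NAME, nothing in the tree modified: this seat's M1–M3 (`…BackgroundPairSpaceMatrix`,
`…BackgroundLayerFirstOrderMatrix`, `…BackgroundLayerFirstOrderMatrixFull`: `bgInstanceM₁`, `bgFamilyM₁4`, `ne2PlusOperator_backgroundM₁4`, `liftBlk`, `liftMap`)
and `…VectorPieceBackgroundFirstOrder` (`uniform_layer_firstOrder`, `pieceM`; through it n15-a parts 27∕26∕16∕15: `unitTorusGeoS`, `pieceG`∕`pieceD1`∕`pieceS`∕
`pieceD3`, `thetaV`, `VecIndexS`, `blkFine`, `kingPrV`, `rweight`).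

WHAT THIS IS.  M3 proves `NE2PlusOperator` BY NAME for ANY family whose only displayed hypotheses are the `U ≡ 1` layer ON THE PRODUCT CARRIER `X × ι`: majorants
and η-defects of pieces acting on `𝔤`-valued fields.  The honest inhabitant is the U = 1 vector single-scale piece `G = H_k·C^{(k)}·(η^{d+1}H_kᵀ)` acting
COMPONENTWISE in the Lie-algebra index — `G ⊗ 1_𝔤` — exactly Bałaban's `U ≡ 1` Landau-gauge propagator on `𝔤`-valued 1-forms.  §1 proves that the lift
`tensorId ι` carries a block majorant of `T` (blocks `blk`) to the same majorant of `T ⊗ 1` (blocks `liftBlk blk ι`) and commutes with the η-difference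
(`idef_tensorId`); §2 lifts `uniform_layer_firstOrder` (all twelve `U ≡ 1` families, ONE `(β, δ, m₀)`); §3 is ONE `exact ne2PlusOperator_backgroundM₁4 …`.

CONTENTS.
* §1 `tensorId` (`tensorId_apply`), **`hasMaj_tensorId`**, **`idef_tensorId`**.
* §2 `bgVecInstanceM₁`, `bgVecFamilyM₁4`, `bgVecInstanceM₁_gf_M` (`rfl`: guard = `j.Msz`, LIVE), **`uniform_layer_firstOrderM`** (the twelve lifted families).
* §3 **`ne2PlusOperator_vectorPiece_backgroundM₁4`**: for `d + 1 ≥ 2`, `L ≥ 1`, `ι` a nonempty finite index type and every `c₃₅ > 0`,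
  `T4EtaRate.NE2PlusOperator c₃₅ (bgVecInstanceM₁ ι L hL) (bgVecFamilyM₁4 ι L hL)` — M3 instantiated; `_dim4`.

HONEST FRAMING ∕ LIMITS.  A knit: no new estimate beyond §1's two transfer lemmas (every analytic input is a landed theorem of the -a∕-b∕-c chains).  What the
statement covers: the LINEAR (U = 1) vector piece of [B5]∕[B6]∕King (4.42), tensored with `1_𝔤`, dressed by the NON-ABELIAN first-order coefficient species with
ABSTRACT matrix coefficients `(C′, A′_μ)` regular in the (3.35) sense entry by entry and linearised entrywise block-average transport — NOT YET the print's
coefficients DERIVED from a gauge field through `exp(iη ad_A)` (parts 13b∕16∕18 letters; the sequel), NOT the (C3) nonlinear transport, NOT the multiscale carrier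
of NODE 00; one single-scale piece.  Count-neutral (typed 28∕28 · discharged unchanged); NOT a discharge of N15; one finite T⁴ at fixed ε — NOT infinite volume,
NOT OS on ℝ⁴, NOT a mass gap, NOT Clay.
-/

noncomputable section

open scoped BigOperators
open Finset

namespace Summit.QuantumFields.YangMills.BalabanUVNodes.N15.VectorPiece

open Literature.MathematicalPhysics.QuantumFieldTheory.Balaban1983to89
open Literature.MathematicalPhysics.QuantumFieldTheory.Balaban1983to89.B11SectG (BlockNorm HasMaj RowSum)
open Literature.MathematicalPhysics.QuantumFieldTheory.Balaban1983to89.B6RandomWalk (Triangle254)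
open Literature.MathematicalPhysics.QuantumFieldTheory.Balaban1983to89.T4EtaRate (PairedInstance NE2PlusOperator)
open Literature.MathematicalPhysics.QuantumFieldTheory.Balaban1983to89.T4EtaRateDefect (idef idef_apply rateWeight)
open Literature.MathematicalPhysics.QuantumFieldTheory.Balaban1983to89.T4EtaRateCoeffDefect (pull pull_apply FibreOsc)
open Literature.MathematicalPhysics.QuantumFieldTheory.Balaban1983to89.B11AxialTransport190 (abs_le_loc_ofBlocks loc_ofBlocks_le)
open Literature.MathematicalPhysics.QuantumFieldTheory.Balaban1983to89.B5Prop11Plancherel (Tor fine)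
open Literature.MathematicalPhysics.QuantumFieldTheory.Balaban1983to89.B6UnitTorusCarrier (unitTorusGeo unitTorusGeo_len triangle254_unitTorusGeo
  rowSum_unitTorusGeo)
open Literature.MathematicalPhysics.QuantumFieldTheory.King1986.Torus (tdistT tdistT_nonneg)
open Summit.QuantumFields.YangMills.BalabanUVNodes.N15.MatrixSpecies (liftMap liftBlk)
open Summit.QuantumFields.YangMills.BalabanUVNodes.N15.BackgroundLayer (bgInstanceM₁ bgFamilyM₁4 ne2PlusOperator_backgroundM₁4)

variable {d : ℕ}

/-! ## §1 The componentwise lift `T ⊗ 1_ι`: majorant and defect transfer -/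

section Tensor

variable {X X₂ X' X₂' : Type} (ι : Type)

/-- THE COMPONENTWISE LIFT `T ⊗ 1_ι` of a real lattice operator to `𝔤 ≅ ℝ^ι`-valued fields: `(T ⊗ 1)f (x, i) = T(f(·, i))(x)` — the `U ≡ 1` propagator of
[B6] acting on `𝔤`-valued 1-forms diagonally in the Lie-algebra index. [cite: Balaban1984PropagatorsII, (2.156) p.250 (the U ≡ 1 propagator on 𝔤-valued forms: shape)] -/
def tensorId (T : (X → ℝ) →ₗ[ℝ] (X₂ → ℝ)) : (X × ι → ℝ) →ₗ[ℝ] (X₂ × ι → ℝ) where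
  toFun f p := T (fun x => f (x, p.2)) p.1
  map_add' f f' := funext fun p => by
    show T ((fun x => f (x, p.2)) + fun x => f' (x, p.2)) p.1 = T (fun x => f (x, p.2)) p.1 + T (fun x => f' (x, p.2)) p.1
    rw [map_add]
    rfl
  map_smul' c f := funext fun p => by
    show T (c • fun x => f (x, p.2)) p.1 = c * T (fun x => f (x, p.2)) p.1
    rw [map_smul]
    rfl

/-- Unfolding. [folklore] -/
@[simp] theorem tensorId_apply (T : (X → ℝ) →ₗ[ℝ] (X₂ → ℝ)) (f : X × ι → ℝ) (p : X₂ × ι) : tensorId ι T f p = T (fun x => f (x, p.2)) p.1 := rfl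

/-- THE LIFT COMMUTES WITH THE η-DIFFERENCE: `𝔇(T′ ⊗ 1, T ⊗ 1)` through the lifted pairings is `𝔇(T′, T) ⊗ 1`. [folklore] -/
theorem idef_tensorId (π : X' → X) (π₂ : X₂' → X₂) (T' : (X' → ℝ) →ₗ[ℝ] (X₂' → ℝ)) (T : (X → ℝ) →ₗ[ℝ] (X₂ → ℝ)) :
    idef (pull (liftMap π ι)) (pull (liftMap π₂ ι)) (tensorId ι T') (tensorId ι T) = tensorId ι (idef (pull π) (pull π₂) T' T) :=
  LinearMap.ext fun _ => funext fun _ => rfl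

variable [Fintype X] [Fintype X₂] [Fintype ι] {g : B6.Geometry}

/-- **THE LIFT KEEPS A BLOCK MAJORANT.**  If `T` has the block majorant `K ≥ 0` between the sharp block norms of `blk`, `blk₂`, then `T ⊗ 1_ι` has the SAME
majorant between the sharp block norms of the product carriers (`liftBlk blk ι`, `liftBlk blk₂ ι`): every `ι`-slice of a field localised in a block is localised
in that block, and a slice's block size is at most the field's. [folklore] -/
theorem hasMaj_tensorId {blk : X → g.Site} {blk₂ : X₂ → g.Site} {T : (X → ℝ) →ₗ[ℝ] (X₂ → ℝ)} {K : g.Site → g.Site → ℝ}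
    (hK : ∀ y y', 0 ≤ K y y') (h : HasMaj (BlockNorm.ofBlocks g blk) (BlockNorm.ofBlocks g blk₂) T K) :
    HasMaj (BlockNorm.ofBlocks g (liftBlk blk ι)) (BlockNorm.ofBlocks g (liftBlk blk₂ ι)) (tensorId ι T) K := by
  intro y' f hf y
  have hf' : ∀ p : X × ι, blk p.1 ≠ y' → f p = 0 := hf
  have hL0 := (BlockNorm.ofBlocks g (liftBlk blk ι)).loc_nonneg y' f
  refine loc_ofBlocks_le (liftBlk blk₂ ι) _ (mul_nonneg (hK y y') hL0) fun p hp => ?_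
  have hloc : (BlockNorm.ofBlocks g blk).IsLoc y' (fun x => f (x, p.2)) := fun x hx => hf' (x, p.2) hx
  have h1 := h y' _ hloc y
  have h2 : |tensorId ι T f p| ≤ (BlockNorm.ofBlocks g blk₂).loc y (T fun x => f (x, p.2)) := abs_le_loc_ofBlocks blk₂ _ hp
  have h3 : (BlockNorm.ofBlocks g blk).loc y' (fun x => f (x, p.2)) ≤ (BlockNorm.ofBlocks g (liftBlk blk ι)).loc y' f :=
    loc_ofBlocks_le blk _ hL0 fun x hx => abs_le_loc_ofBlocks (liftBlk blk ι) f (x' := (x, p.2)) hx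
  exact h2.trans (h1.trans (mul_le_mul_of_nonneg_left h3 (hK y y')))

end Tensor

/-! ## §2 The realised non-abelian instance family and the lifted U ≡ 1 layer -/

section Family

variable (ι : Type) [Fintype ι] [DecidableEq ι] (L : ℕ) [NeZero L]

/-- THE REALISED NON-ABELIAN FIRST-ORDER BACKGROUND INSTANCE at a sized index: M2's `bgInstanceM₁` (directions `J = Fin (d + 1)`, Lie-algebra index `ι`) over the
SIZED unit-torus carrier, blocks `blkFine`, King's pairing, scale shift `m`, rate number `θ_j` (matrix coefficient carriers `coeffBgM₁` = the (3.35) letter pair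
on every entry of `C′` and of every `A′_μ`, with the index's `M`). [cite: Balaban1985BackgroundPropagators, Thm 3.14 pp.426–427 (typing template); (3.35) p.396; (3.50)–(3.52) p.400 (shape)] -/
def bgVecInstanceM₁ (hL : 1 ≤ L) (j : VecIndexS d L) : PairedInstance :=
  bgInstanceM₁ (Fin (d + 1)) ι (g := unitTorusGeoS L j.k j.Mn j.Msz) (blkFine L j.k j.Mn) (kingPrV L j.k j.m j.Mn) j.m (unitTorusGeoS_L_ne_zero L hL j)
    (thetaV L j) (thetaV L j)

/-- THE REALISED NON-ABELIAN KERNEL FAMILY: M3's `bgFamilyM₁4` (all four (3.42) entries of the non-abelian first-order pair CONSTRUCTED) fed with the -a pieces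
of the vector single-scale piece TENSORED WITH `1_𝔤` at the index, both spacings (direction `ν = j.ν`). [cite: Balaban1985BackgroundPropagators, (3.42) + (3.44) p.397, (3.63)–(3.65) pp.402–403 (shapes, mechanism)] -/
def bgVecFamilyM₁4 (hL : 1 ≤ L) (j : VecIndexS d L) : B9.KernelFamily (bgVecInstanceM₁ (d := d) ι L hL j).gc (bgVecInstanceM₁ (d := d) ι L hL j).Bf :=
  bgFamilyM₁4 (g := unitTorusGeoS L j.k j.Mn j.Msz) (blkFine L j.k j.Mn) (kingPrV L j.k j.m j.Mn) j.m (unitTorusGeoS_L_ne_zero L hL j) (thetaV L j) (thetaV L j)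
    j.ν
    (tensorId ι (pieceG L j.Mn (L ^ j.k) j.k (rweight (d := d) L j.k))) (tensorId ι (pieceS L j.Mn (L ^ j.k) j.k (rweight (d := d) L j.k) j.ν))
    (tensorId ι (pieceD3 L j.Mn (L ^ j.k) j.k (rweight (d := d) L j.k)))
    (fun μ => tensorId ι (pieceD1 L j.Mn (L ^ j.k) j.k (rweight (d := d) L j.k) μ))
    (fun μ => tensorId ι (pieceM L j.Mn (L ^ j.k) j.k (rweight (d := d) L j.k) μ j.ν))
    (tensorId ι (pieceG L j.Mn (L ^ j.m * L ^ j.k) (j.k + j.m) (rweight (d := d) L j.k / ((L : ℝ) ^ j.m) ^ (d + 1))))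
    (tensorId ι (pieceS L j.Mn (L ^ j.m * L ^ j.k) (j.k + j.m) (rweight (d := d) L j.k / ((L : ℝ) ^ j.m) ^ (d + 1)) j.ν))
    (tensorId ι (pieceD3 L j.Mn (L ^ j.m * L ^ j.k) (j.k + j.m) (rweight (d := d) L j.k / ((L : ℝ) ^ j.m) ^ (d + 1))))
    (fun μ => tensorId ι (pieceD1 L j.Mn (L ^ j.m * L ^ j.k) (j.k + j.m) (rweight (d := d) L j.k / ((L : ℝ) ^ j.m) ^ (d + 1)) μ))
    (fun μ => tensorId ι (pieceM L j.Mn (L ^ j.m * L ^ j.k) (j.k + j.m) (rweight (d := d) L j.k / ((L : ℝ) ^ j.m) ^ (d + 1)) μ j.ν))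

omit [DecidableEq ι] in
/-- **THE GUARD IS LIVE**: the fine realised non-abelian instance's [B9] size parameter IS the index's `M`. [folklore] -/
theorem bgVecInstanceM₁_gf_M (hL : 1 ≤ L) (j : VecIndexS d L) : (bgVecInstanceM₁ (d := d) ι L hL j).gf.M = j.Msz := rfl

variable {ι L}

omit [DecidableEq ι] in
/-- **THE UNIFORM U ≡ 1 LAYER, TENSORED WITH `1_𝔤`.**  `uniform_layer_firstOrder` lifted by `hasMaj_tensorId` ∕ `idef_tensorId`: ONE `(β, δ, m₀)` for the seven
plain majorants and five η-defects of the lifted pieces on the product carriers, at every sized index. [cite: King1986, (4.42)–(4.43) p.675 (mechanism); Balaban1985BackgroundPropagators, (3.42) + (3.44) p.397 (shapes)] -/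
theorem uniform_layer_firstOrderM (hd : 1 ≤ d) (hL : 1 ≤ L) :
    ∃ β δ m₀ : ℝ, 0 < β ∧ 0 < δ ∧ 0 < m₀ ∧ ∀ j : VecIndexS d L,
      HasMaj (BlockNorm.ofBlocks (unitTorusGeoS L j.k j.Mn j.Msz) (liftBlk (blkFine L j.k j.Mn) ι))
          (BlockNorm.ofBlocks (unitTorusGeoS L j.k j.Mn j.Msz) (liftBlk (blkFine L j.k j.Mn) ι))
          (tensorId ι (pieceG L j.Mn (L ^ j.k) j.k (rweight (d := d) L j.k)))
          (fun y y' => β * Real.exp (-(δ * (unitTorusGeoS L j.k j.Mn j.Msz).dist y y')))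
      ∧ (∀ μ, HasMaj (BlockNorm.ofBlocks (unitTorusGeoS L j.k j.Mn j.Msz) (liftBlk (blkFine L j.k j.Mn) ι))
          (BlockNorm.ofBlocks (unitTorusGeoS L j.k j.Mn j.Msz) (liftBlk (blkFine L j.k j.Mn) ι))
          (tensorId ι (pieceD1 L j.Mn (L ^ j.k) j.k (rweight (d := d) L j.k) μ))
          (fun y y' => β * Real.exp (-(δ * (unitTorusGeoS L j.k j.Mn j.Msz).dist y y'))))
      ∧ HasMaj (BlockNorm.ofBlocks (unitTorusGeoS L j.k j.Mn j.Msz) (liftBlk (blkFine L j.k j.Mn ∘ kingPrV L j.k j.m j.Mn) ι))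
          (BlockNorm.ofBlocks (unitTorusGeoS L j.k j.Mn j.Msz) (liftBlk (blkFine L j.k j.Mn ∘ kingPrV L j.k j.m j.Mn) ι))
          (tensorId ι (pieceG L j.Mn (L ^ j.m * L ^ j.k) (j.k + j.m) (rweight (d := d) L j.k / ((L : ℝ) ^ j.m) ^ (d + 1))))
          (fun y y' => β * Real.exp (-(δ * (unitTorusGeoS L j.k j.Mn j.Msz).dist y y')))
      ∧ (∀ μ, HasMaj (BlockNorm.ofBlocks (unitTorusGeoS L j.k j.Mn j.Msz) (liftBlk (blkFine L j.k j.Mn ∘ kingPrV L j.k j.m j.Mn) ι))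
          (BlockNorm.ofBlocks (unitTorusGeoS L j.k j.Mn j.Msz) (liftBlk (blkFine L j.k j.Mn ∘ kingPrV L j.k j.m j.Mn) ι))
          (tensorId ι (pieceD1 L j.Mn (L ^ j.m * L ^ j.k) (j.k + j.m) (rweight (d := d) L j.k / ((L : ℝ) ^ j.m) ^ (d + 1)) μ))
          (fun y y' => β * Real.exp (-(δ * (unitTorusGeoS L j.k j.Mn j.Msz).dist y y'))))
      ∧ HasMaj (BlockNorm.ofBlocks (unitTorusGeoS L j.k j.Mn j.Msz) (liftBlk (blkFine L j.k j.Mn) ι))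
          (BlockNorm.ofBlocks (unitTorusGeoS L j.k j.Mn j.Msz) (liftBlk (blkFine L j.k j.Mn) ι))
          (tensorId ι (pieceS L j.Mn (L ^ j.k) j.k (rweight (d := d) L j.k) j.ν))
          (fun y y' => β * Real.exp (-(δ * (unitTorusGeoS L j.k j.Mn j.Msz).dist y y')))
      ∧ (∀ μ, HasMaj (BlockNorm.ofBlocks (unitTorusGeoS L j.k j.Mn j.Msz) (liftBlk (blkFine L j.k j.Mn) ι))
          (BlockNorm.ofBlocks (unitTorusGeoS L j.k j.Mn j.Msz) (liftBlk (blkFine L j.k j.Mn) ι))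
          (tensorId ι (pieceM L j.Mn (L ^ j.k) j.k (rweight (d := d) L j.k) μ j.ν))
          (fun y y' => β * Real.exp (-(δ * (unitTorusGeoS L j.k j.Mn j.Msz).dist y y'))))
      ∧ HasMaj (BlockNorm.ofBlocks (unitTorusGeoS L j.k j.Mn j.Msz) (liftBlk (blkFine L j.k j.Mn ∘ kingPrV L j.k j.m j.Mn) ι))
          (BlockNorm.ofBlocks (unitTorusGeoS L j.k j.Mn j.Msz) (liftBlk (blkFine L j.k j.Mn ∘ kingPrV L j.k j.m j.Mn) ι))
          (tensorId ι (pieceD3 L j.Mn (L ^ j.m * L ^ j.k) (j.k + j.m) (rweight (d := d) L j.k / ((L : ℝ) ^ j.m) ^ (d + 1))))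
          (fun y y' => β * Real.exp (-(δ * (unitTorusGeoS L j.k j.Mn j.Msz).dist y y')))
      ∧ HasMaj (BlockNorm.ofBlocks (unitTorusGeoS L j.k j.Mn j.Msz) (liftBlk (blkFine L j.k j.Mn) ι))
          (BlockNorm.ofBlocks (unitTorusGeoS L j.k j.Mn j.Msz) (liftBlk (blkFine L j.k j.Mn ∘ kingPrV L j.k j.m j.Mn) ι))
          (idef (pull (liftMap (kingPrV L j.k j.m j.Mn) ι)) (pull (liftMap (kingPrV L j.k j.m j.Mn) ι))
            (tensorId ι (pieceG L j.Mn (L ^ j.m * L ^ j.k) (j.k + j.m) (rweight (d := d) L j.k / ((L : ℝ) ^ j.m) ^ (d + 1))))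
            (tensorId ι (pieceG L j.Mn (L ^ j.k) j.k (rweight (d := d) L j.k))))
          (fun y y' => m₀ * thetaV L j * Real.exp (-(δ * (unitTorusGeoS L j.k j.Mn j.Msz).dist y y')))
      ∧ (∀ μ, HasMaj (BlockNorm.ofBlocks (unitTorusGeoS L j.k j.Mn j.Msz) (liftBlk (blkFine L j.k j.Mn) ι))
          (BlockNorm.ofBlocks (unitTorusGeoS L j.k j.Mn j.Msz) (liftBlk (blkFine L j.k j.Mn ∘ kingPrV L j.k j.m j.Mn) ι))
          (idef (pull (liftMap (kingPrV L j.k j.m j.Mn) ι)) (pull (liftMap (kingPrV L j.k j.m j.Mn) ι))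
            (tensorId ι (pieceD1 L j.Mn (L ^ j.m * L ^ j.k) (j.k + j.m) (rweight (d := d) L j.k / ((L : ℝ) ^ j.m) ^ (d + 1)) μ))
            (tensorId ι (pieceD1 L j.Mn (L ^ j.k) j.k (rweight (d := d) L j.k) μ)))
          (fun y y' => m₀ * thetaV L j * Real.exp (-(δ * (unitTorusGeoS L j.k j.Mn j.Msz).dist y y'))))
      ∧ HasMaj (BlockNorm.ofBlocks (unitTorusGeoS L j.k j.Mn j.Msz) (liftBlk (blkFine L j.k j.Mn) ι))
          (BlockNorm.ofBlocks (unitTorusGeoS L j.k j.Mn j.Msz) (liftBlk (blkFine L j.k j.Mn ∘ kingPrV L j.k j.m j.Mn) ι))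
          (idef (pull (liftMap (kingPrV L j.k j.m j.Mn) ι)) (pull (liftMap (kingPrV L j.k j.m j.Mn) ι))
            (tensorId ι (pieceS L j.Mn (L ^ j.m * L ^ j.k) (j.k + j.m) (rweight (d := d) L j.k / ((L : ℝ) ^ j.m) ^ (d + 1)) j.ν))
            (tensorId ι (pieceS L j.Mn (L ^ j.k) j.k (rweight (d := d) L j.k) j.ν)))
          (fun y y' => m₀ * thetaV L j * Real.exp (-(δ * (unitTorusGeoS L j.k j.Mn j.Msz).dist y y')))
      ∧ (∀ μ, HasMaj (BlockNorm.ofBlocks (unitTorusGeoS L j.k j.Mn j.Msz) (liftBlk (blkFine L j.k j.Mn) ι))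
          (BlockNorm.ofBlocks (unitTorusGeoS L j.k j.Mn j.Msz) (liftBlk (blkFine L j.k j.Mn ∘ kingPrV L j.k j.m j.Mn) ι))
          (idef (pull (liftMap (kingPrV L j.k j.m j.Mn) ι)) (pull (liftMap (kingPrV L j.k j.m j.Mn) ι))
            (tensorId ι (pieceM L j.Mn (L ^ j.m * L ^ j.k) (j.k + j.m) (rweight (d := d) L j.k / ((L : ℝ) ^ j.m) ^ (d + 1)) μ j.ν))
            (tensorId ι (pieceM L j.Mn (L ^ j.k) j.k (rweight (d := d) L j.k) μ j.ν)))
          (fun y y' => m₀ * thetaV L j * Real.exp (-(δ * (unitTorusGeoS L j.k j.Mn j.Msz).dist y y'))))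
      ∧ HasMaj (BlockNorm.ofBlocks (unitTorusGeoS L j.k j.Mn j.Msz) (liftBlk (blkFine L j.k j.Mn) ι))
          (BlockNorm.ofBlocks (unitTorusGeoS L j.k j.Mn j.Msz) (liftBlk (blkFine L j.k j.Mn ∘ kingPrV L j.k j.m j.Mn) ι))
          (idef (pull (liftMap (kingPrV L j.k j.m j.Mn) ι)) (pull (liftMap (kingPrV L j.k j.m j.Mn) ι))
            (tensorId ι (pieceD3 L j.Mn (L ^ j.m * L ^ j.k) (j.k + j.m) (rweight (d := d) L j.k / ((L : ℝ) ^ j.m) ^ (d + 1))))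
            (tensorId ι (pieceD3 L j.Mn (L ^ j.k) j.k (rweight (d := d) L j.k))))
          (fun y y' => m₀ * thetaV L j * Real.exp (-(δ * (unitTorusGeoS L j.k j.Mn j.Msz).dist y y'))) := by
  obtain ⟨β, δ, m₀, hβ, hδ, hm₀, H⟩ := uniform_layer_firstOrder (d := d) (L := L) hd hL
  refine ⟨β, δ, m₀, hβ, hδ, hm₀, fun j => ?_⟩
  obtain ⟨hG, hD, hG', hD', hS, hSD, hD3', hDG, hDD, hDS, hDSD, hDD3⟩ := H j
  have hx0 : (0 : ℝ) < (L : ℝ) ^ j.k := pow_pos (by exact_mod_cast (show 0 < L by omega)) _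
  have hθ0 : 0 ≤ thetaV L j := Real.rpow_nonneg hx0.le _
  have hβe : ∀ y y' : (unitTorusGeoS L j.k j.Mn j.Msz).Site, 0 ≤ β * Real.exp (-(δ * (unitTorusGeoS L j.k j.Mn j.Msz).dist y y')) :=
    fun _ _ => mul_nonneg hβ.le (Real.exp_nonneg _)
  have hme : ∀ y y' : (unitTorusGeoS L j.k j.Mn j.Msz).Site, 0 ≤ m₀ * thetaV L j * Real.exp (-(δ * (unitTorusGeoS L j.k j.Mn j.Msz).dist y y')) :=
    fun _ _ => mul_nonneg (mul_nonneg hm₀.le hθ0) (Real.exp_nonneg _)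
  refine ⟨hasMaj_tensorId ι hβe hG, fun μ => hasMaj_tensorId ι hβe (hD μ), hasMaj_tensorId ι hβe hG', fun μ => hasMaj_tensorId ι hβe (hD' μ),
    hasMaj_tensorId ι hβe hS, fun μ => hasMaj_tensorId ι hβe (hSD μ), hasMaj_tensorId ι hβe hD3', ?_, fun μ => ?_, ?_, fun μ => ?_, ?_⟩
  · rw [idef_tensorId]; exact hasMaj_tensorId ι hme hDG
  · rw [idef_tensorId]; exact hasMaj_tensorId ι hme (hDD μ)
  · rw [idef_tensorId]; exact hasMaj_tensorId ι hme hDS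
  · rw [idef_tensorId]; exact hasMaj_tensorId ι hme (hDSD μ)
  · rw [idef_tensorId]; exact hasMaj_tensorId ι hme hDD3

end Family

/-! ## §3 THE NON-ABELIAN KNIT: `NE2PlusOperator` BY NAME, matrix coefficient species, every U ≡ 1 input a tree theorem -/

section Knit

variable {ι : Type} [Fintype ι] [DecidableEq ι] [Nonempty ι] {L : ℕ} [NeZero L]

/-- **NE2⁺, OPERATOR LAYER — THE NODE's FIRST CONJUNCT `T4EtaRate.NE2PlusOperator` BY NAME FOR THE U = 1 VECTOR SINGLE-SCALE PIECE `G ⊗ 1_𝔤` DRESSED BY THE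
NON-ABELIAN FIRST-ORDER SPECIES `V = M_C + Σ_μ M_{A_μ}∘∇_μ` (MATRIX coefficients on `𝔤 ≅ ℝ^ι`)**, on the realised family indexed by the sized indices: (3.35)
CONSUMED on every entry of every matrix coefficient, the size guard LIVE (`bgVecInstanceM₁_gf_M`, unbounded `M`), all four (3.42) entries of the non-abelian
first-order pair CONSTRUCTED (M1∕M3), and EVERY U ≡ 1 input — the twelve hypothesis families of M3's `ne2PlusOperator_backgroundM₁4`, lifted by `tensorId` — a
landed theorem (§2).  M3 instantiated. [cite: Balaban1985BackgroundPropagators, Thm 3.1 p.397 (quantifier template), (3.35) p.396, (3.42) + (3.44) p.397, (3.50)–(3.52) p.400, (3.63)–(3.65) pp.402–403 (shapes, mechanism); King1986, (4.42)–(4.43) p.675; Balaban1984PropagatorsII, (2.156) p.250] -/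
theorem ne2PlusOperator_vectorPiece_backgroundM₁4 (hd : 1 ≤ d) (hL : 1 ≤ L) (c35 : ℝ) (hc35 : 0 < c35) :
    NE2PlusOperator c35 (bgVecInstanceM₁ (d := d) ι L hL) (bgVecFamilyM₁4 (d := d) ι L hL) := by
  obtain ⟨β, δ, m₀, hβ, hδ, hm₀, H⟩ := uniform_layer_firstOrderM (d := d) (ι := ι) (L := L) hd hL
  have hL0 : L ≠ 0 := by omega
  have hLr : (0 : ℝ) < (L : ℝ) := by exact_mod_cast (show 0 < L by omega)
  have hσ : 0 < δ / 2 := half_pos hδ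
  exact ne2PlusOperator_backgroundM₁4 (I := VecIndexS d L) (J := Fin (d + 1)) (ι := ι) (fun j => unitTorusGeoS L j.k j.Mn j.Msz)
    (fun j => Tor (fine (L ^ j.k) j.Mn) × Fin (d + 1)) (fun j => Tor (fine (L ^ j.m * L ^ j.k) j.Mn) × Fin (d + 1))
    (fun j => blkFine L j.k j.Mn) (fun j => kingPrV L j.k j.m j.Mn) (fun j => j.m) (fun j => unitTorusGeoS_L_ne_zero L hL j) (thetaV L) (thetaV L)
    (fun j => j.ν)
    (fun j => tensorId ι (pieceG L j.Mn (L ^ j.k) j.k (rweight (d := d) L j.k)))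
    (fun j => tensorId ι (pieceS L j.Mn (L ^ j.k) j.k (rweight (d := d) L j.k) j.ν))
    (fun j => tensorId ι (pieceD3 L j.Mn (L ^ j.k) j.k (rweight (d := d) L j.k)))
    (fun j μ => tensorId ι (pieceD1 L j.Mn (L ^ j.k) j.k (rweight (d := d) L j.k) μ))
    (fun j μ => tensorId ι (pieceM L j.Mn (L ^ j.k) j.k (rweight (d := d) L j.k) μ j.ν))
    (fun j => tensorId ι (pieceG L j.Mn (L ^ j.m * L ^ j.k) (j.k + j.m) (rweight (d := d) L j.k / ((L : ℝ) ^ j.m) ^ (d + 1))))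
    (fun j => tensorId ι (pieceS L j.Mn (L ^ j.m * L ^ j.k) (j.k + j.m) (rweight (d := d) L j.k / ((L : ℝ) ^ j.m) ^ (d + 1)) j.ν))
    (fun j => tensorId ι (pieceD3 L j.Mn (L ^ j.m * L ^ j.k) (j.k + j.m) (rweight (d := d) L j.k / ((L : ℝ) ^ j.m) ^ (d + 1))))
    (fun j μ => tensorId ι (pieceD1 L j.Mn (L ^ j.m * L ^ j.k) (j.k + j.m) (rweight (d := d) L j.k / ((L : ℝ) ^ j.m) ^ (d + 1)) μ))
    (fun j μ => tensorId ι (pieceM L j.Mn (L ^ j.m * L ^ j.k) (j.k + j.m) (rweight (d := d) L j.k / ((L : ℝ) ^ j.m) ^ (d + 1)) μ j.ν))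
    c35 hc35 (fun j => triangle254_unitTorusGeo L j.k j.Mn) (fun j a b => tdistT_nonneg _ _ _) hσ.le
    (B4Sect5Proof.latticeConst_nonneg (d + 1) hσ.le) (fun j => rowSum_unitTorusGeo L j.k j.Mn hσ)
    (fun j => inv_pos.mpr (pow_pos hLr _)) (fun j => hLr) (fun j y => (unitTorusGeo_len L j.k j.Mn hL0 y).symm.le)
    (by linarith) hβ.le hm₀.le (by norm_num : (0 : ℝ) < 1 / 4) (fun j => Real.rpow_nonneg (pow_nonneg hLr.le _) _) (fun j y => le_rfl)
    (fun j => (H j).1) (fun j => (H j).2.1) (fun j => (H j).2.2.1) (fun j => (H j).2.2.2.1) (fun j => (H j).2.2.2.2.1)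
    (fun j => (H j).2.2.2.2.2.1) (fun j => (H j).2.2.2.2.2.2.1) (fun j => (H j).2.2.2.2.2.2.2.1) (fun j => (H j).2.2.2.2.2.2.2.2.1)
    (fun j => (H j).2.2.2.2.2.2.2.2.2.1) (fun j => (H j).2.2.2.2.2.2.2.2.2.2.1) (fun j => (H j).2.2.2.2.2.2.2.2.2.2.2)

/-- The four-dimensional non-abelian instance (`d + 1 = 4`; e.g. `ι = Fin 3` for `𝔤 = su(2)`). [cite: Balaban1985BackgroundPropagators, Thm 3.1 p.397 (quantifier template)] -/
theorem ne2PlusOperator_vectorPiece_backgroundM₁4_dim4 (hL : 1 ≤ L) (c35 : ℝ) (hc35 : 0 < c35) :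
    NE2PlusOperator c35 (bgVecInstanceM₁ (d := 3) ι L hL) (bgVecFamilyM₁4 (d := 3) ι L hL) :=
  ne2PlusOperator_vectorPiece_backgroundM₁4 (d := 3) (by norm_num) hL c35 hc35

end Knit

end Summit.QuantumFields.YangMills.BalabanUVNodes.N15.VectorPiece

end
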